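/-
Copyright (c) 2026 the pub-hodgecm-mathlib formalisation cell (harness21).  Prover seat hodgecm-mathlib-K2E1-p10 (g0), Track B ∕ K2-LIT, h413 = `stmt-HodgeConjecture-24833`,
line `K2_E1_TraceFormulaBeta`, campaign «EIS-WHITTAKER-3», WAVE 2 letter «W-hWbd₃» (dealer K2E1-plan (g5) RULING 2026-09-04T08:54:29Z «P3 NOW»): the divisor-type GROWTH of the
finite Whittaker part of `U(2,1)_{L∕L⁺}` is a product over places `v` of the BASE field of products over the places `w ∣ v` of the CM field — ★ #1b re-indexed along `(v, w ∣ v) ↔ w`.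
-/
import Summits.HodgeConjecture.HodgeConjecture.Theorems.K2E1WhittakerBoundsUniformU2      -- ★ #1b (K2E2-p12 g5): `exists_prod_two_mul_succ_le_of_mem_primePowBall` (generic number field)
import Literature.NumberTheory.AdelicBaseChange.IntegralClosureLocalization              -- ★ `Extension`, `Extension.fintype`, `preimageComapFinset` (FLT packet)
import HarnessLib

/-!
# K2·E1 — `K2E1WhittakerGrowthPlacesOverU3` («EIS-WHITTAKER-3», «W-hWbd₃», P3): `∏_{v ∈ T} ∏_{w ∣ v} 2(n_w(ξ)+1) ≤ C·(1 + ‖ξ_∞‖)^{2[L:ℚ]}` — ★ #1b RE-INDEXED ALONG `(v, w ∣ v) ↔ w`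

Track B ∕ K2-LIT, crux h413 = `stmt-HodgeConjecture-24833`, route of record `HCCMUnconditional`; cell `hodgecm-mathlib`, squad K2, ENGINE E1 (campaign «EIS-WHITTAKER-3», WAVE 2).
THEOREMS ONLY (no `def`, no `instance`, no notation, no named-fact hypothesis, no `sorry`; default heartbeats); lane `--supports stmt-HodgeConjecture-24833 --as helper` (count-neutral).
GENERIC: an extension of number fields `L ∕ K` (`= L ∕ L⁺`), places `v : HeightOneSpectrum (𝓞 K)`, `w : HeightOneSpectrum (𝓞 L)`, the finite type `v.Extension (𝓞 L) = {w // w.under = v}`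
of places above `v` (★ FLT packet `Extension.fintype`), `preimageComapFinset T` = the places of `L` above a finset `T` of places of `K`.  TOKEN-FREE (no local integral appears).

THE MATHEMATICS [Garrett2018, §2.8; NeukirchANT1999, Ch. III (1.3)].  The finite part of the `ξ`-th Whittaker coefficient of the spherical Eisenstein series on `U(2,1)_{L∕L⁺}` is a product
over the finite set `S(ξ)` of places `v` OF `L⁺` (W0₃ CONVENTIONS §6), and the bound of the `v`-factor is a function of the orders `n_w = ord_w ξ − e_w` at the places `w ∣ v` OF `L`
(inert: `4(n_w+1) ≤ (2(n_w+1))²`, ★ C1₃; split: a constant `≤ (2(n_w+1))^k` at a `w ∣ v` with `n_w ≥ 1`, ★ C1₃-split `K2E1LocalWhittakerPackageSplitU3`; bad: `B·(n_w+1)`, ★ D-W5).  So the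
global growth is `∏_{v ∈ S(ξ)} ∏_{w ∣ v, (w ∈ S₀ ∨ n_w ≥ 1)} 2(n_w+1)`, raised to a fixed power — and by the re-indexing `∏_{v ∈ T} ∏_{w ∣ v} f(w) = ∏_{w above T} f(w)` this is ★ #1b's
divisor-type product over places of `L`: `≤ C·(1 + ‖ξ_∞‖)^{2[L:ℚ]}` for `ξ ∈ Lˣ` in the box `ξ ∈ 𝔭_w^{e_w}` (`e_w = 0` for almost all `w`).
* §1 **`prod_extension_eq_prod_preimageComapFinset`** — `∏_{v ∈ T} ∏_{w : v.Extension} f(w) = ∏_{w ∈ preimageComapFinset T} f(w)` (the fibres of `under` over `T` partition the places above `T`).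
* §2 **`exists_prod_extension_two_mul_succ_le`** — ONE `C > 0` (depending on `e`, `S₀` only) with, for every `ξ ≠ 0` in the box, every finset `T` of places of `K` and every `n` such
  that at each `w ∣ v ∈ T` with `w ∈ S₀ ∨ 1 ≤ n_w` one has `ξ ∈ 𝔭_w^{e_w+n_w} ∖ 𝔭_w^{e_w+n_w+1}`:
  `∏_{v ∈ T} ∏_{w : v.Extension} (if w ∈ S₀ ∨ 1 ≤ n_w then 2(n_w+1) else 1) ≤ C·(1 + ‖ξ_∞‖)^{2[L:ℚ]}`; and the `k`-th power form **`…_pow_le`** (`≤ C^k·(1+‖ξ_∞‖)^{2[L:ℚ]k}`) that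
  C2₃ multiplies against the per-place package bounds.
SAT-WITNESS: nothing is quantified over a structure (`L ∕ K` any extension of number fields, `e` any cofinitely-zero box, `S₀` any finset).
HONEST LABEL: HC_CM is proved only modulo the 7 printed citations (2 remaining named inputs: hLiu418 = `stmt-HodgeConjecture-24832`, h413 = `stmt-HodgeConjecture-24833`)
until rung 0 closes; this file asserts no named fact and closes no socket; count-neutral.
References: [Garrett2018] §2.8 (divisor-type growth of Fourier–Whittaker coefficients) · [NeukirchANT1999] Ch. III (1.3) (product formula), Ch. I §8 (primes above a prime).
-/

set_option autoImplicit false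
-- the mandated namespace repeats the single-problem summit's segment (`HodgeConjecture.HodgeConjecture`)
set_option linter.dupNamespace false

noncomputable section

open scoped NNReal Classical
open NumberField NumberField.mixedEmbedding IsDedekindDomain IsDedekindDomain.HeightOneSpectrum Module Filter
open Literature.NumberTheory.Automorphic
open Summit.HodgeConjecture.HodgeConjecture.Cruxes.H413.K2E1WhittakerBoundsUniformU2 (exists_prod_two_mul_succ_le_of_mem_primePowBall)

namespace Summit.HodgeConjecture.HodgeConjecture.Cruxes.H413.K2E1WhittakerGrowthPlacesOverU3

variable {K L : Type} [Field K] [NumberField K] [Field L] [NumberField L] [Algebra K L]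

/-! ## §1  Re-indexing along `(v, w ∣ v) ↔ w` -/

/-- Membership in `preimageComapFinset T`: `w` lies above `T` iff `w.under ∈ T`. [folklore] -/
theorem mem_preimageComapFinset_iff (T : Finset (HeightOneSpectrum (𝓞 K))) (w : HeightOneSpectrum (𝓞 L)) :
    w ∈ preimageComapFinset (𝓞 K) K L (𝓞 L) T ↔ w.under (𝓞 K) ∈ T := by
  rw [preimageComapFinset, Set.Finite.mem_toFinset, Set.mem_preimage, Finset.mem_coe]

/-- **RE-INDEXING**: for a finset `T` of places of `K` and any `f`, `∏_{v ∈ T} ∏_{w : v.Extension (𝓞 L)} f(w) = ∏_{w ∈ preimageComapFinset T} f(w)` — the places of `L` above `T` are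
partitioned by the fibres of `under`, and the fibre above `v` is the finite type `v.Extension (𝓞 L)`. [cite: NeukirchANT1999, Ch. I §8] -/
theorem prod_extension_eq_prod_preimageComapFinset {M : Type*} [CommMonoid M] (T : Finset (HeightOneSpectrum (𝓞 K))) (f : HeightOneSpectrum (𝓞 L) → M) :
    ∏ v ∈ T, (letI := Extension.fintype (𝓞 K) K L (𝓞 L) v; ∏ w : v.Extension (𝓞 L), f w.1) = ∏ w ∈ preimageComapFinset (𝓞 K) K L (𝓞 L) T, f w := by
  rw [← Finset.prod_fiberwise_of_maps_to (s := preimageComapFinset (𝓞 K) K L (𝓞 L) T) (t := T) (g := fun w : HeightOneSpectrum (𝓞 L) => w.under (𝓞 K))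
    (fun w hw => (mem_preimageComapFinset_iff T w).1 hw) f]
  refine Finset.prod_congr rfl fun v hv => ?_
  letI := Extension.fintype (𝓞 K) K L (𝓞 L) v
  rw [Finset.prod_subtype (F := Extension.fintype (𝓞 K) K L (𝓞 L) v) ((preimageComapFinset (𝓞 K) K L (𝓞 L) T).filter fun w => w.under (𝓞 K) = v)
    (p := fun w : HeightOneSpectrum (𝓞 L) => w.under (𝓞 K) = v) (fun w => ?_) f]
  · rfl
  · rw [Finset.mem_filter, mem_preimageComapFinset_iff]
    exact ⟨fun h => h.2, fun h => ⟨h ▸ hv, h⟩⟩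

/-! ## §2  The divisor-type growth, re-indexed -/

/-- **THE GROWTH OF THE FINITE WHITTAKER PART, INDEXED BY PLACES OF THE BASE.**  Let `e : places(L) → ℤ` vanish for almost all `w` (the box) and `S₀` a finset of places of `L`.  There is
`C > 0` such that for every `ξ ∈ Lˣ` with `ξ ∈ 𝔭_w^{e_w}` for all `w`, every finset `T` of places of `K` and every `n : places(L) → ℕ` satisfying, at each `w ∣ v ∈ T` with
`w ∈ S₀ ∨ 1 ≤ n_w`, `ξ ∈ 𝔭_w^{e_w+n_w} ∖ 𝔭_w^{e_w+n_w+1}` (`n_w` IS the order of `ξ` above the box at `w`):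
`∏_{v ∈ T} ∏_{w : v.Extension (𝓞 L)} (if w ∈ S₀ ∨ 1 ≤ n_w then 2(n_w+1) else 1) ≤ C·(1 + ‖ξ_∞‖)^{2[L:ℚ]}` (★ #1b over the places of `L` above `T` that carry a factor).
[cite: Garrett2018, §2.8] [cite: NeukirchANT1999, Ch. III (1.3)] -/
theorem exists_prod_extension_two_mul_succ_le {e : HeightOneSpectrum (𝓞 L) → ℤ} (he : ∀ᶠ w in cofinite, e w = 0) (S₀ : Finset (HeightOneSpectrum (𝓞 L))) :
    ∃ C : ℝ, 0 < C ∧ ∀ ξ : L, ξ ≠ 0 → (∀ w : HeightOneSpectrum (𝓞 L), (ξ : w.adicCompletion L) ∈ primePowBall (w.adicCompletion L) (e w)) →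
      ∀ (T : Finset (HeightOneSpectrum (𝓞 K))) (n : HeightOneSpectrum (𝓞 L) → ℕ),
        (∀ v ∈ T, ∀ w : v.Extension (𝓞 L), (w.1 ∈ S₀ ∨ 1 ≤ n w.1) →
          (ξ : w.1.adicCompletion L) ∈ primePowBall (w.1.adicCompletion L) (e w.1 + n w.1) ∧
            (ξ : w.1.adicCompletion L) ∉ primePowBall (w.1.adicCompletion L) (e w.1 + n w.1 + 1)) →
        ∏ v ∈ T, (letI := Extension.fintype (𝓞 K) K L (𝓞 L) v; ∏ w : v.Extension (𝓞 L), (if w.1 ∈ S₀ ∨ 1 ≤ n w.1 then 2 * ((n w.1 : ℝ) + 1) else 1)) ≤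
          C * (1 + ‖mixedEmbedding L ξ‖) ^ (2 * finrank ℚ L) := by
  obtain ⟨C, hC, h⟩ := exists_prod_two_mul_succ_le_of_mem_primePowBall (K := L) he S₀
  refine ⟨C, hC, fun ξ hξ hbox T n hT => ?_⟩
  rw [prod_extension_eq_prod_preimageComapFinset T (fun w => if w ∈ S₀ ∨ 1 ≤ n w then 2 * ((n w : ℝ) + 1) else 1), ← Finset.prod_filter]
  refine h ξ hξ hbox _ n fun w hw => ?_
  rw [Finset.mem_filter, mem_preimageComapFinset_iff] at hw
  obtain ⟨h1, h2⟩ := hT (w.under (𝓞 K)) hw.1 ⟨w, rfl⟩ hw.2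
  exact ⟨h1, h2, hw.2⟩

/-- **The `k`-th power form** (what C2₃ multiplies against per-place package bounds of the shape `B·(∏_{w ∣ v} …)^k`): under the same hypotheses,
`(∏_{v ∈ T} ∏_{w : v.Extension} (if … then 2(n_w+1) else 1))^k ≤ C^k·(1 + ‖ξ_∞‖)^{2[L:ℚ]·k}`. [cite: Garrett2018, §2.8] -/
theorem exists_prod_extension_two_mul_succ_pow_le {e : HeightOneSpectrum (𝓞 L) → ℤ} (he : ∀ᶠ w in cofinite, e w = 0) (S₀ : Finset (HeightOneSpectrum (𝓞 L))) (k : ℕ) :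
    ∃ C : ℝ, 0 < C ∧ ∀ ξ : L, ξ ≠ 0 → (∀ w : HeightOneSpectrum (𝓞 L), (ξ : w.adicCompletion L) ∈ primePowBall (w.adicCompletion L) (e w)) →
      ∀ (T : Finset (HeightOneSpectrum (𝓞 K))) (n : HeightOneSpectrum (𝓞 L) → ℕ),
        (∀ v ∈ T, ∀ w : v.Extension (𝓞 L), (w.1 ∈ S₀ ∨ 1 ≤ n w.1) →
          (ξ : w.1.adicCompletion L) ∈ primePowBall (w.1.adicCompletion L) (e w.1 + n w.1) ∧
            (ξ : w.1.adicCompletion L) ∉ primePowBall (w.1.adicCompletion L) (e w.1 + n w.1 + 1)) →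
        (∏ v ∈ T, (letI := Extension.fintype (𝓞 K) K L (𝓞 L) v; ∏ w : v.Extension (𝓞 L), (if w.1 ∈ S₀ ∨ 1 ≤ n w.1 then 2 * ((n w.1 : ℝ) + 1) else 1))) ^ k ≤
          C ^ k * (1 + ‖mixedEmbedding L ξ‖) ^ (2 * finrank ℚ L * k) := by
  obtain ⟨C, hC, h⟩ := exists_prod_extension_two_mul_succ_le (K := K) he S₀
  refine ⟨C, hC, fun ξ hξ hbox T n hT => ?_⟩
  have hnn : 0 ≤ ∏ v ∈ T, (letI := Extension.fintype (𝓞 K) K L (𝓞 L) v; ∏ w : v.Extension (𝓞 L), (if w.1 ∈ S₀ ∨ 1 ≤ n w.1 then 2 * ((n w.1 : ℝ) + 1) else 1)) :=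
    Finset.prod_nonneg fun v _ => Finset.prod_nonneg fun w _ => by split_ifs <;> positivity
  rw [pow_mul, ← mul_pow]
  exact pow_le_pow_left₀ hnn (h ξ hξ hbox T n hT) k

/-- **Per-place factors are at least `1`** (so a sub-product over `S(ξ) ⊆ T` is bounded by the full product): each `(if … then 2(n_w+1) else 1) ≥ 1`. [folklore] -/
theorem one_le_prod_extension_ite (S₀ : Finset (HeightOneSpectrum (𝓞 L))) (n : HeightOneSpectrum (𝓞 L) → ℕ) (v : HeightOneSpectrum (𝓞 K)) :
    1 ≤ (letI := Extension.fintype (𝓞 K) K L (𝓞 L) v; ∏ w : v.Extension (𝓞 L), (if w.1 ∈ S₀ ∨ 1 ≤ n w.1 then 2 * ((n w.1 : ℝ) + 1) else 1)) := by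
  letI := Extension.fintype (𝓞 K) K L (𝓞 L) v
  have h1 : ∀ w ∈ (Finset.univ : Finset (v.Extension (𝓞 L))), (1 : ℝ) ≤ (if w.1 ∈ S₀ ∨ 1 ≤ n w.1 then 2 * ((n w.1 : ℝ) + 1) else 1) := by
    intro w _
    split_ifs
    · have : (0 : ℝ) ≤ n w.1 := Nat.cast_nonneg _
      linarith
    · exact le_rfl
  calc (1 : ℝ) = ∏ _w : v.Extension (𝓞 L), (1 : ℝ) := Finset.prod_const_one.symm
    _ ≤ ∏ w : v.Extension (𝓞 L), (if w.1 ∈ S₀ ∨ 1 ≤ n w.1 then 2 * ((n w.1 : ℝ) + 1) else 1) := Finset.prod_le_prod (fun _ _ => zero_le_one) h1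

/-- **A split place carries a factor `≥ 4` when some `w ∣ v` has `n_w ≥ 1`** (absorbs the split package's constant `M ≤ 4^k`: `M ≤ (∏_{w∣v} …)^k`). [folklore] -/
theorem four_le_prod_extension_ite_of_exists (S₀ : Finset (HeightOneSpectrum (𝓞 L))) (n : HeightOneSpectrum (𝓞 L) → ℕ) (v : HeightOneSpectrum (𝓞 K))
    (hv : ∃ w : v.Extension (𝓞 L), 1 ≤ n w.1) :
    4 ≤ (letI := Extension.fintype (𝓞 K) K L (𝓞 L) v; ∏ w : v.Extension (𝓞 L), (if w.1 ∈ S₀ ∨ 1 ≤ n w.1 then 2 * ((n w.1 : ℝ) + 1) else 1)) := by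
  letI := Extension.fintype (𝓞 K) K L (𝓞 L) v
  obtain ⟨w₀, hw₀⟩ := hv
  have h1 : ∀ w : v.Extension (𝓞 L), (1 : ℝ) ≤ (if w.1 ∈ S₀ ∨ 1 ≤ n w.1 then 2 * ((n w.1 : ℝ) + 1) else 1) := by
    intro w
    split_ifs
    · have : (0 : ℝ) ≤ n w.1 := Nat.cast_nonneg _
      linarith
    · exact le_rfl
  have hw₀' : (4 : ℝ) ≤ (if w₀.1 ∈ S₀ ∨ 1 ≤ n w₀.1 then 2 * ((n w₀.1 : ℝ) + 1) else 1) := by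
    rw [if_pos (Or.inr hw₀)]
    have : (1 : ℝ) ≤ n w₀.1 := by exact_mod_cast hw₀
    linarith
  calc (4 : ℝ) ≤ (if w₀.1 ∈ S₀ ∨ 1 ≤ n w₀.1 then 2 * ((n w₀.1 : ℝ) + 1) else 1) := hw₀'
    _ = ∏ w : v.Extension (𝓞 L), (if w = w₀ then (if w₀.1 ∈ S₀ ∨ 1 ≤ n w₀.1 then 2 * ((n w₀.1 : ℝ) + 1) else 1) else 1) := by
        rw [Finset.prod_ite_eq', if_pos (Finset.mem_univ _)]
    _ ≤ ∏ w : v.Extension (𝓞 L), (if w.1 ∈ S₀ ∨ 1 ≤ n w.1 then 2 * ((n w.1 : ℝ) + 1) else 1) := by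
        refine Finset.prod_le_prod (fun w _ => ?_) (fun w _ => ?_)
        · split
          · exact le_trans (by norm_num : (0 : ℝ) ≤ 4) hw₀'
          · exact zero_le_one
        · by_cases hw : w = w₀
          · subst hw; rw [if_pos rfl]
          · rw [if_neg hw]; exact h1 w

end Summit.HodgeConjecture.HodgeConjecture.Cruxes.H413.K2E1WhittakerGrowthPlacesOverU3

end
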